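import Summits.AtomisticToContinuum.FouriersLaw.Theorems.JunctionLocalityNonBallisticLightConePropagationAux1
import Mathlib.Data.Fin.Tuple.Take

/-!
# Cross-length Lipschitz bound for the forces of the pinned chain on a boundary window

Helper file (`--supports stmt-AtomisticToContinuum-12240`, item `HalfChainLocality` of route
`BoundaryEscapeDeficit`, sub-problem `FouriersLaw`). Two pinned anharmonic chains of DIFFERENT lengths
`ℓ+1 ≤ N` have literally the same equations of motion at the sites `k < ℓ` (pinning force, the two
bonds to `k ± 1`, and the Langevin friction/noise, which act at site `0` in both and otherwise only at
the respective right ends `ℓ`, `N-1 ≥ ℓ`). This file records the bookkeeping behind that sentence: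

* `bathWeight_window_eq` — for `k < ℓ` the bath weight of site `k` is `[k = 0]` in both chains;
* `pinnedChain_abs_dPotential_window_sub_le` — for `k < ℓ`, positions in `[-R, R]` on the window
  `{0, …, ℓ}` and window deviations `|q'_j - q_j| ≤ d_j`:
  `|∂_kΦ_{ℓ+1}(q') - ∂_kΦ_N(q)| ≤ (ω₂ + 3 lam R² + 2(1 + 12βR²)) d_k + (1 + 12βR²)([k ≠ 0] d_{k-1} + d_{k+1})`
  (the cross-length analogue of the tree's `NonBallistic.pinnedChain_abs_dPotential_sub_le`);
* `pinnedChain_abs_drift_window_sub_le` — the same for the momentum drift, with the friction term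
  `γ [k = 0] |p'_k - p_k|`.

Folklore; no definitions.
-/

noncomputable section

open MeasureTheory Set

namespace Summit.AtomisticToContinuum.FouriersLaw.Theorems.HalfChainLocality

open Literature.MathematicalPhysics.KineticTheory.HeatConduction
open Summit.AtomisticToContinuum.FouriersLaw.Theorems.NonBallistic
open Summit.AtomisticToContinuum.FouriersLaw.Theorems.NonBallistic.LightConePropagation

variable {ω₂ lam β γ : ℝ}

/-- On the window `k < ℓ` (`1 ≤ ℓ`, `ℓ + 1 ≤ N`) the bath weight of site `k` is `[k = 0]`, both in the
`(ℓ+1)`-chain and in the `N`-chain. [folklore] -/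
theorem bathWeight_window_eq {ℓ N : ℕ} (hℓN : ℓ + 1 ≤ N) (k : ℕ) (hk : k < ℓ) :
    OscillatorChain.bathWeight (ℓ + 1) ⟨k, by omega⟩ = (if k = 0 then 1 else 0) ∧
      OscillatorChain.bathWeight N ⟨k, by omega⟩ = (if k = 0 then 1 else 0) := by
  unfold OscillatorChain.bathWeight
  constructor
  · rw [if_neg (show ¬ k = ℓ + 1 - 1 by omega), add_zero]
  · rw [if_neg (show ¬ k = N - 1 by omega), add_zero]

/-- **Cross-length Lipschitz bound for the force on the window.** For `k < ℓ`, `ℓ + 1 ≤ N`, positions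
`q` (of the `N`-chain) and `q'` (of the `(ℓ+1)`-chain) in `[-R, R]` on the sites `≤ ℓ`, and
`|q'_j - q_j| ≤ d_j` (`j ≤ ℓ`, `d ≥ 0`):
`|∂_kΦ_{ℓ+1}(q') - ∂_kΦ_N(q)| ≤ (ω₂ + 3 lam R² + 2(1+12βR²)) d_k + (1+12βR²)([k ≠ 0] d_{k-1} + d_{k+1})`.
[folklore] -/
theorem pinnedChain_abs_dPotential_window_sub_le (hω : 0 ≤ ω₂) (hl : 0 ≤ lam) (hβ : 0 ≤ β) (γ : ℝ)
    {ℓ N : ℕ} (hℓN : ℓ + 1 ≤ N) {R : ℝ} {q : Fin N → ℝ} {q' : Fin (ℓ + 1) → ℝ}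
    (hq : ∀ (j : ℕ) (hj : j ≤ ℓ), |q ⟨j, by omega⟩| ≤ R) (hq' : ∀ (j : ℕ) (hj : j ≤ ℓ), |q' ⟨j, by omega⟩| ≤ R)
    {d : ℕ → ℝ} (hd0 : ∀ j, 0 ≤ d j)
    (hd : ∀ (j : ℕ) (hj : j ≤ ℓ), |q' ⟨j, by omega⟩ - q ⟨j, by omega⟩| ≤ d j)
    (k : ℕ) (hk : k < ℓ) :
    |(pinnedChain ω₂ lam β γ).dPotential (ℓ + 1) ⟨k, by omega⟩ q' -
        (pinnedChain ω₂ lam β γ).dPotential N ⟨k, by omega⟩ q| ≤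
      (ω₂ + 3 * lam * R ^ 2 + 2 * (1 + 12 * β * R ^ 2)) * d k +
        (1 + 12 * β * R ^ 2) * ((if k = 0 then 0 else d (k - 1)) + d (k + 1)) := by
  rw [OscillatorChain.dPotential_eq_closed, OscillatorChain.dPotential_eq_closed]
  simp only [pinnedChain_deriv_U, pinnedChain_deriv_V]
  rw [dif_pos (show k + 1 < ℓ + 1 by omega), dif_pos (show k + 1 < N by omega)]
  set KV := 1 + 12 * β * R ^ 2 with hKV_def
  have hR : 0 ≤ R := (abs_nonneg _).trans (hq 0 (Nat.zero_le _))
  have hKV : 0 ≤ KV := by positivity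
  -- pinning term
  have hU : |(ω₂ * q' ⟨k, by omega⟩ + lam * q' ⟨k, by omega⟩ ^ 3) - (ω₂ * q ⟨k, by omega⟩ + lam * q ⟨k, by omega⟩ ^ 3)| ≤
      (ω₂ + 3 * lam * R ^ 2) * d k :=
    (abs_cubic_sub_cubic_le hω hl (hq' k hk.le) (hq k hk.le)).trans
      (mul_le_mul_of_nonneg_left (hd k hk.le) (by positivity))
  -- a bond term: `|V'(a') - V'(a)| ≤ KV |a' - a|` for stretches `|a|, |a'| ≤ 2R`
  have hV : ∀ (j m : ℕ) (hj : j ≤ ℓ) (hm : m ≤ ℓ),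
      |(q' ⟨m, by omega⟩ - q' ⟨j, by omega⟩ + β * (q' ⟨m, by omega⟩ - q' ⟨j, by omega⟩) ^ 3) -
        (q ⟨m, by omega⟩ - q ⟨j, by omega⟩ + β * (q ⟨m, by omega⟩ - q ⟨j, by omega⟩) ^ 3)| ≤
      KV * (d m + d j) := by
    intro j m hj hm
    have h2R' : |q' ⟨m, by omega⟩ - q' ⟨j, by omega⟩| ≤ 2 * R :=
      (abs_sub _ _).trans (by linarith [hq' m hm, hq' j hj])
    have h2R : |q ⟨m, by omega⟩ - q ⟨j, by omega⟩| ≤ 2 * R :=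
      (abs_sub _ _).trans (by linarith [hq m hm, hq j hj])
    have h := abs_cubic_sub_cubic_le (c₁ := 1) zero_le_one hβ h2R' h2R
    rw [one_mul, one_mul] at h
    refine h.trans ?_
    have e : (1 + 3 * β * (2 * R) ^ 2) = KV := by rw [hKV_def]; ring
    rw [e]
    refine mul_le_mul_of_nonneg_left ?_ hKV
    calc |q' ⟨m, by omega⟩ - q' ⟨j, by omega⟩ - (q ⟨m, by omega⟩ - q ⟨j, by omega⟩)|
        = |(q' ⟨m, by omega⟩ - q ⟨m, by omega⟩) - (q' ⟨j, by omega⟩ - q ⟨j, by omega⟩)| := by ring_nf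
      _ ≤ |q' ⟨m, by omega⟩ - q ⟨m, by omega⟩| + |q' ⟨j, by omega⟩ - q ⟨j, by omega⟩| := abs_sub _ _
      _ ≤ d m + d j := add_le_add (hd m hm) (hd j hj)
  -- left bond
  have hL : |(if h : 0 < k then q' ⟨k, by omega⟩ - q' ⟨k - 1, by omega⟩ + β * (q' ⟨k, by omega⟩ - q' ⟨k - 1, by omega⟩) ^ 3
        else 0) -
      (if h : 0 < k then q ⟨k, by omega⟩ - q ⟨k - 1, by omega⟩ + β * (q ⟨k, by omega⟩ - q ⟨k - 1, by omega⟩) ^ 3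
        else 0)| ≤ KV * (d k + (if k = 0 then 0 else d (k - 1))) := by
    by_cases h : 0 < k
    · rw [dif_pos h, dif_pos h, if_neg (show k ≠ 0 by omega)]
      exact hV (k - 1) k (by omega) hk.le
    · rw [dif_neg h, dif_neg h, if_pos (show k = 0 by omega), sub_zero, abs_zero, add_zero]
      exact mul_nonneg hKV (hd0 _)
  -- right bond
  have hRb : |(q' ⟨k + 1, by omega⟩ - q' ⟨k, by omega⟩ + β * (q' ⟨k + 1, by omega⟩ - q' ⟨k, by omega⟩) ^ 3) -
      (q ⟨k + 1, by omega⟩ - q ⟨k, by omega⟩ + β * (q ⟨k + 1, by omega⟩ - q ⟨k, by omega⟩) ^ 3)| ≤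
      KV * (d (k + 1) + d k) := hV k (k + 1) hk.le (by omega)
  -- combine
  have key : ∀ (u u' v v' w w' : ℝ), (u' + v' - w') - (u + v - w) = (u' - u) + (v' - v) - (w' - w) := by
    intros; ring
  rw [key]
  refine (abs_sub _ _).trans ((add_le_add ((abs_add_le _ _).trans (add_le_add hU hL)) hRb).trans ?_)
  have h1 := hd0 k
  have h2 := hd0 (k + 1)
  have h3 : 0 ≤ (if k = 0 then 0 else d (k - 1)) := by split_ifs <;> simp [hd0]
  nlinarith

/-- **Cross-length Lipschitz bound for the momentum drift on the window**: as
`pinnedChain_abs_dPotential_window_sub_le`, plus the friction `γ [k = 0] |p'_k - p_k| ≤ γ e_k` for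
momentum deviations `|p'_k - p_k| ≤ e_k`. [folklore] -/
theorem pinnedChain_abs_drift_window_sub_le (hω : 0 ≤ ω₂) (hl : 0 ≤ lam) (hβ : 0 ≤ β) (hγ : 0 ≤ γ)
    {ℓ N : ℕ} (hℓN : ℓ + 1 ≤ N) {R : ℝ} {z : PhaseSpace N} {z' : PhaseSpace (ℓ + 1)}
    (hq : ∀ (j : ℕ) (hj : j ≤ ℓ), |z.1 ⟨j, by omega⟩| ≤ R) (hq' : ∀ (j : ℕ) (hj : j ≤ ℓ), |z'.1 ⟨j, by omega⟩| ≤ R)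
    {d : ℕ → ℝ} (hd0 : ∀ j, 0 ≤ d j)
    (hd : ∀ (j : ℕ) (hj : j ≤ ℓ), |z'.1 ⟨j, by omega⟩ - z.1 ⟨j, by omega⟩| ≤ d j)
    (k : ℕ) (hk : k < ℓ) {e : ℝ} (he : |z'.2 ⟨k, by omega⟩ - z.2 ⟨k, by omega⟩| ≤ e) :
    |((pinnedChain ω₂ lam β γ).drift (ℓ + 1) z').2 ⟨k, by omega⟩ -
        ((pinnedChain ω₂ lam β γ).drift N z).2 ⟨k, by omega⟩| ≤
      (ω₂ + 3 * lam * R ^ 2 + 2 * (1 + 12 * β * R ^ 2)) * d k +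
        (1 + 12 * β * R ^ 2) * ((if k = 0 then 0 else d (k - 1)) + d (k + 1)) + γ * e := by
  rw [pinnedChain_drift_apply, pinnedChain_drift_apply]
  dsimp only
  obtain ⟨hb1, hb2⟩ := bathWeight_window_eq (ℓ := ℓ) (N := N) hℓN k hk
  rw [hb1, hb2]
  have hF := pinnedChain_abs_dPotential_window_sub_le hω hl hβ γ hℓN hq hq' hd0 hd k hk
  have hfr : |γ * (if k = 0 then (1:ℝ) else 0) * z'.2 ⟨k, by omega⟩ - γ * (if k = 0 then (1:ℝ) else 0) * z.2 ⟨k, by omega⟩| ≤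
      γ * e := by
    rw [← mul_sub, abs_mul]
    have hw : |γ * (if k = 0 then (1:ℝ) else 0)| ≤ γ := by
      split_ifs <;> simp [abs_of_nonneg hγ, hγ]
    exact mul_le_mul hw he (abs_nonneg _) hγ
  have key : ∀ F F' f f' : ℝ, (-F' - f') - (-F - f) = -((F' - F) + (f' - f)) := by intros; ring
  rw [key, abs_neg]
  exact (abs_add_le _ _).trans (add_le_add hF hfr)

end Summit.AtomisticToContinuum.FouriersLaw.Theorems.HalfChainLocality

end
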